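import Summits.AtomisticToContinuum.Crystallization.Theorems.FrustratedLawDichotomyStrainedPatchHomCurvCentreLabel
import Summits.AtomisticToContinuum.Crystallization.Theorems.FrustratedLawDichotomyStrainedPatchHomHertzKit
import Summits.AtomisticToContinuum.Crystallization.Theorems.FrustratedLawDichotomyStrainedPatchHomCurvLeaf2

/-!
# The CENTRED (Lipschitz-Hessian) curvature leaf `curvCheckL` and its soundness in the exact `hcurv` shape of `curv_floor_of_curvCheck2`

decomp-a2c hand-1 g27 (crux `AperiodicFrustratedLawGap`, stmt-AtomisticToContinuum-27623; `(H) HomFloor (1/625)`, hcp half; lever (C), critic rows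
1040 (b) / 1044 / 1050 (C); hand-1 g27 FINDING «loss budget»).  Labels come in two lists: CENTRED labels `Lc` (expanded to second order around the
box centre, `…HomCurvCentreLabel.label_floor_bump/_lj`) and NAIVE labels `Ln` (per-label interval coefficients over the box, exactly as
`…HomCurvLeaf.curvCheck2`).  The kernel assembles

* the matrix part `E = Σ_{Lc} h_b(p_b)` (centre, tight) `+ Σ_{Ln} h_b(C_b)` (box) with `…HomCurvKit.hessEntryFI`;
* the first-order perturbation bound `W_ij = cdiv(Σ_kl w_kl·|G_kl,ij| + Σ_k u_k·|T_k,ij|, SC)`, `G_kl = Σ_{Lc} (w_b)_l ∂_kh_b`, `T_k = Σ_{Lc} ∂_kh_b`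
  (label sums BEFORE absolute values — keeps the inter-label cancellation);
* the one-sided second-order remainder `remS = Σ_{Lc} cdiv(KS_b·nd2S_b, 2·SC)`;

and tests `hertzTest E W (lamS + remS)` (sign-vertex + exact LDLᵀ).  ★★★ `curv_floor_of_curvCheckL`: the `hcurv` input of
`…HomConvexSegmentW45.hcpShifted_floor_W45` for the label set `Lc ++ Ln`, with the SAME hypotheses and conclusion shape as `curv_floor_of_curvCheck2`.

Kernel definitions + soundness; 0 sorry; standard axioms; no instances / notation / `#eval`.  `--supports stmt-AtomisticToContinuum-27623`.
-/

noncomputable section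

namespace Summit.AtomisticToContinuum.Crystallization.Theorems.FrustratedLawDichotomyStrainedPatchHomCurvLeafL

open scoped BigOperators RealInnerProductSpace
open Literature.Analysis.ValidatedNumerics.Numerics
open Summit.AtomisticToContinuum.Crystallization.Theorems.ChargedEnergyGapNegative (E3)
open Summit.AtomisticToContinuum.Crystallization.Theorems.FrustratedLawDichotomySchurCut (effPot w₄₅ ω₄)
open Summit.AtomisticToContinuum.Crystallization.Theorems.FrustratedLawDichotomyStrainedPatchHomSplit (latPt hexFrame hcpShift)
open Summit.AtomisticToContinuum.Crystallization.Theorems.FrustratedLawDichotomyStrainedPatchHomEntryGram (entryFI mem_entryFI)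
open Summit.AtomisticToContinuum.Crystallization.Theorems.FrustratedLawDichotomyStrainedPatchHomEntryGramHcp (dot3 shufFI mem_dot3 mem_shufFI)
open Summit.AtomisticToContinuum.Crystallization.Theorems.FrustratedLawDichotomyStrainedPatchHomForceKit (vecB mem_vecB)
open Summit.AtomisticToContinuum.Crystallization.Theorems.FrustratedLawDichotomyStrainedPatchHomCurvCoeff (wFI coeffFI2 mem_coeffFI2 rhoFI)
open Summit.AtomisticToContinuum.Crystallization.Theorems.FrustratedLawDichotomyStrainedPatchHomCurvCoeff3 (kTermS)
open Summit.AtomisticToContinuum.Crystallization.Theorems.FrustratedLawDichotomyStrainedPatchHomCurvKit (accFI mem_accFI hessEntryFI mem_hessEntryFI)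
open Summit.AtomisticToContinuum.Crystallization.Theorems.FrustratedLawDichotomyStrainedPatchHomHertzKit (hertzTest quadForm_ge_of_hertzTest)
open Summit.AtomisticToContinuum.Crystallization.Theorems.FrustratedLawDichotomyStrainedPatchHomConvexCurvature
  (segGd_eq_rankOne rankOne_term_eq_sum norm_sq_eq_sum)
open Summit.AtomisticToContinuum.Crystallization.Theorems.FrustratedLawDichotomyStrainedPatchHomCurvCentre
  (pert_rearrange pert_abs_le sum_floor_collect)
open Summit.AtomisticToContinuum.Crystallization.Theorems.FrustratedLawDichotomyStrainedPatchHomCurvCentreKit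
open Summit.AtomisticToContinuum.Crystallization.Theorems.FrustratedLawDichotomyStrainedPatchHomCurvLeaf (abs_sub_le_of_segment)
open Summit.AtomisticToContinuum.Crystallization.Theorems.FrustratedLawDichotomyStrainedPatchTaylorChord (segR segGd)
open Summit.AtomisticToContinuum.Crystallization.Theorems.FrustratedLawDichotomyStrainedPatchTaylorLeaves (junctions)
open Summit.AtomisticToContinuum.Crystallization.Theorems.FrustratedLawDichotomyStrainedPatchHomLatticeBoxHcp (norm_shifted_gt)

/-! ## §1. Per-label accessors (flat `Option` data) and the per-label floor -/

/-- Default triple. -/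
def dflt3 : FI × FI × FI := (FI.ofInt 0, FI.ofInt 0, FI.ofInt 0)

/-- `(α, α′ρ, α″ρ²)` over the tube. -/
def ttOf (c w : (Fin 3 × Fin 3) ⊕ Fin 3 → ℤ) (b : Fin 3 → ℤ) : Option (FI × FI × FI) :=
  tripleAt (tube c w b) ((tube c w b).mul (tube c w b)) (wFI (tube c w b))
/-- `(α, α′ρ, α″ρ²)` at the centre radius. -/
def t0Of (c w : (Fin 3 × Fin 3) ⊕ Fin 3 → ℤ) (b : Fin 3 → ℤ) : Option (FI × FI × FI) :=
  tripleAt (tube c w b) (dot3 (cenVec c b) (cenVec c b)) (wFI (rhoFI (dot3 (cenVec c b) (cenVec c b))))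
/-- `(α, β)` at the centre radius. -/
def abOf (c : (Fin 3 × Fin 3) ⊕ Fin 3 → ℤ) (b : Fin 3 → ℤ) : Option (FI × FI) := coeffFI2 (dot3 (cenVec c b) (cenVec c b))
/-- `α′(ρ₀)/ρ₀ = (α′ρ)(ρ₀)/ρ₀²`. -/
def a1qOf (c w : (Fin 3 × Fin 3) ⊕ Fin 3 → ℤ) (b : Fin 3 → ℤ) : Option FI :=
  FI.divPos ((t0Of c w b).getD dflt3).2.1 (dot3 (cenVec c b) (cenVec c b))
/-- The label can be centred. -/
def labelOK (c w : (Fin 3 × Fin 3) ⊕ Fin 3 → ℤ) (b : Fin 3 → ℤ) : Bool :=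
  (ttOf c w b).isSome && (t0Of c w b).isSome && (abOf c b).isSome && (a1qOf c w b).isSome
/-- `α(ρ₀)` enclosure. -/
def A0of (c : (Fin 3 × Fin 3) ⊕ Fin 3 → ℤ) (b : Fin 3 → ℤ) : FI := ((abOf c b).getD (FI.ofInt 0, FI.ofInt 0)).1
/-- `β(ρ₀)` enclosure. -/
def B0of (c : (Fin 3 × Fin 3) ⊕ Fin 3 → ℤ) (b : Fin 3 → ℤ) : FI := ((abOf c b).getD (FI.ofInt 0, FI.ofInt 0)).2
/-- `α′(ρ₀)/ρ₀` enclosure. -/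
def A1qof (c w : (Fin 3 × Fin 3) ⊕ Fin 3 → ℤ) (b : Fin 3 → ℤ) : FI := (a1qOf c w b).getD (FI.ofInt 0)
/-- Scaled remainder constant of the label. -/
def KSof (c w : (Fin 3 × Fin 3) ⊕ Fin 3 → ℤ) (b : Fin 3 → ℤ) : ℤ :=
  kTermS ((ttOf c w b).getD dflt3).1 ((ttOf c w b).getD dflt3).2.1 ((ttOf c w b).getD dflt3).2.2
/-- The label record (for `Darr`). -/
def recOf (c w : (Fin 3 × Fin 3) ⊕ Fin 3 → ℤ) (b : Fin 3 → ℤ) : CenLabel := ⟨cenVec c b, wVec c b, A0of c b, B0of c b, A1qof c w b, KSof c w b, nd2S c w b⟩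

/-- ★★ **The per-label floor from `labelOK`** (dispatch over the regime flag to `label_floor_bump / _lj`). [folklore chaining] -/
theorem label_floor {c w : (Fin 3 × Fin 3) ⊕ Fin 3 → ℤ} {b : Fin 3 → ℤ} (h : labelOK c w b = true) (U : E3 →L[ℝ] E3)
    (hbox : ∀ ab : Fin 3 × Fin 3, |(U (EuclideanSpace.single ab.2 (1 : ℝ))) ab.1 - (c (Sum.inl ab) : ℝ) / SC| ≤ (w (Sum.inl ab) : ℝ) / SC)
    (η : E3) (hη : ∀ i : Fin 3, |η i - (c (Sum.inr i) : ℝ) / SC| ≤ (w (Sum.inr i) : ℝ) / SC) (Δ : E3) :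
    FI.mem ((deriv (deriv (effPot w₄₅ ω₄ (3 / 400))) ‖cenPt c b‖ - deriv (effPot w₄₅ ω₄ (3 / 400)) ‖cenPt c b‖ / ‖cenPt c b‖) / ‖cenPt c b‖ ^ 2)
        (A0of c b) ∧
      FI.mem (deriv (effPot w₄₅ ω₄ (3 / 400)) ‖cenPt c b‖ / ‖cenPt c b‖) (B0of c b) ∧
      FI.mem (deriv (fun s => (deriv (deriv (effPot w₄₅ ω₄ (3 / 400))) s - deriv (effPot w₄₅ ω₄ (3 / 400)) s / s) / s ^ 2) ‖cenPt c b‖ /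
        ‖cenPt c b‖) (A1qof c w b) ∧
      (deriv (deriv (effPot w₄₅ ω₄ (3 / 400))) ‖cenPt c b‖ - deriv (effPot w₄₅ ω₄ (3 / 400)) ‖cenPt c b‖ / ‖cenPt c b‖) / ‖cenPt c b‖ ^ 2 *
            ⟪cenPt c b, Δ⟫ ^ 2 + deriv (effPot w₄₅ ω₄ (3 / 400)) ‖cenPt c b‖ / ‖cenPt c b‖ * ‖Δ‖ ^ 2 +
          ∑ i, ∑ j, (∑ k, (latPt U hexFrame b + U (hcpShift + η) - cenPt c b) k *
            Dreal (deriv (fun s => (deriv (deriv (effPot w₄₅ ω₄ (3 / 400))) s - deriv (effPot w₄₅ ω₄ (3 / 400)) s / s) / s ^ 2) ‖cenPt c b‖ /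
                ‖cenPt c b‖)
              ((deriv (deriv (effPot w₄₅ ω₄ (3 / 400))) ‖cenPt c b‖ - deriv (effPot w₄₅ ω₄ (3 / 400)) ‖cenPt c b‖ / ‖cenPt c b‖) / ‖cenPt c b‖ ^ 2)
              (cenPt c b) k i j) * (Δ i * Δ j) -
          (KSof c w b : ℝ) / SC / 2 * ((nd2S c w b : ℝ) / SC) * ‖Δ‖ ^ 2 ≤
        (deriv (deriv (effPot w₄₅ ω₄ (3 / 400))) ‖latPt U hexFrame b + U (hcpShift + η)‖ -
            deriv (effPot w₄₅ ω₄ (3 / 400)) ‖latPt U hexFrame b + U (hcpShift + η)‖ / ‖latPt U hexFrame b + U (hcpShift + η)‖) /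
            ‖latPt U hexFrame b + U (hcpShift + η)‖ ^ 2 * ⟪latPt U hexFrame b + U (hcpShift + η), Δ⟫ ^ 2 +
          deriv (effPot w₄₅ ω₄ (3 / 400)) ‖latPt U hexFrame b + U (hcpShift + η)‖ / ‖latPt U hexFrame b + U (hcpShift + η)‖ * ‖Δ‖ ^ 2 := by
  simp only [labelOK, Bool.and_eq_true] at h
  obtain ⟨⟨⟨htt, ht0⟩, hab⟩, hq⟩ := h
  obtain ⟨tt, htt⟩ := Option.isSome_iff_exists.1 htt
  obtain ⟨t0, ht0⟩ := Option.isSome_iff_exists.1 ht0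
  obtain ⟨ab, hab⟩ := Option.isSome_iff_exists.1 hab
  obtain ⟨a1q, hq⟩ := Option.isSome_iff_exists.1 hq
  have hq' : FI.divPos t0.2.1 (dot3 (cenVec c b) (cenVec c b)) = some a1q := by
    rw [a1qOf, ht0] at hq; simpa using hq
  have eA : A0of c b = ab.1 := by simp [A0of, hab]
  have eB : B0of c b = ab.2 := by simp [B0of, hab]
  have e1 : A1qof c w b = a1q := by simp [A1qof, hq]
  have eK : KSof c w b = kTermS tt.1 tt.2.1 tt.2.2 := by simp [KSof, htt]
  rw [eA, eB, e1, eK]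
  unfold ttOf tripleAt at htt
  unfold t0Of tripleAt at ht0
  cases hB : regBump (tube c w b) with
  | true =>
    simp only [hB, ↓reduceIte] at htt ht0
    exact label_floor_bump hB htt ht0 hab hq' U hbox η hη Δ
  | false =>
    simp only [hB, Bool.false_eq_true, ↓reduceIte] at htt ht0
    cases hL : regLJ (tube c w b) with
    | false => simp [hL] at htt
    | true =>
      simp only [hL, ↓reduceIte] at htt ht0
      exact label_floor_lj hL htt ht0 hab hq' U hbox η hη Δ


/-! ## §2. The Boolean -/

/-- Naive per-label coefficients over the box (as `curvCheck2`). -/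
def naiveK (c w : (Fin 3 × Fin 3) ⊕ Fin 3 → ℤ) (b : Fin 3 → ℤ) : Option (FI × FI) :=
  coeffFI2 (dot3 (vecB (boxE c w) (shufFI c w) b) (vecB (boxE c w) (shufFI c w) b))

/-- Matrix part of the centred labels: `Σ_{Lc} h_b(p_b)` (centre data, tight). -/
def Ec (c : (Fin 3 × Fin 3) ⊕ Fin 3 → ℤ) (Lc : List (Fin 3 → ℤ)) (i j : Fin 3) : FI :=
  hessEntryFI Lc (fun b => A0of c b) (fun b => B0of c b) (fun b => cenVec c b) i j

/-- Matrix part of the naive labels: `Σ_{Ln} h_b(C_b)` (box data). -/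
def En (c w : (Fin 3 × Fin 3) ⊕ Fin 3 → ℤ) (Ln : List (Fin 3 → ℤ)) (i j : Fin 3) : FI :=
  hessEntryFI Ln (fun b => ((naiveK c w b).getD (FI.ofInt 0, FI.ofInt 0)).1) (fun b => ((naiveK c w b).getD (FI.ofInt 0, FI.ofInt 0)).2)
    (fun b => vecB (boxE c w) (shufFI c w) b) i j

/-- First-order array `G_kl,ij = Σ_{Lc} (∂_kh_b)_ij (w_b)_l`. -/
def Garr (c w : (Fin 3 × Fin 3) ⊕ Fin 3 → ℤ) (Lc : List (Fin 3 → ℤ)) (k l i j : Fin 3) : FI :=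
  accFI Lc fun b => (Darr (recOf c w b) k i j).mul (wVec c b l)

/-- First-order array `T_k,ij = Σ_{Lc} (∂_kh_b)_ij`. -/
def Tarr (c w : (Fin 3 × Fin 3) ⊕ Fin 3 → ℤ) (Lc : List (Fin 3 → ℤ)) (k i j : Fin 3) : FI :=
  accFI Lc fun b => Darr (recOf c w b) k i j

/-- Scaled entrywise bound of the first-order perturbation: `cdiv(Σ_kl w_kl·|G_kl,ij| + Σ_k u_k·|T_k,ij|, SC)`. -/
def Wmat (c w : (Fin 3 × Fin 3) ⊕ Fin 3 → ℤ) (Lc : List (Fin 3 → ℤ)) (i j : Fin 3) : ℤ :=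
  cdiv (∑ k : Fin 3, ∑ l : Fin 3, w (Sum.inl (k, l)) * (Garr c w Lc k l i j).absHi + ∑ k : Fin 3, uBound c w k * (Tarr c w Lc k i j).absHi) SC

/-- Scaled one-sided second-order remainder `Σ_{Lc} cdiv(KS_b·nd2S_b, 2·SC)`. -/
def remS (c w : (Fin 3 × Fin 3) ⊕ Fin 3 → ℤ) (Lc : List (Fin 3 → ℤ)) : ℤ := (Lc.map fun b => cdiv (KSof c w b * nd2S c w b) (2 * SC)).sum

/-- ★ **THE CENTRED CURVATURE CHECK** over the box `(c, w)`, centred labels `Lc`, naive labels `Ln`, floor `lamS/SC`. -/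
def curvCheckL (c w : (Fin 3 × Fin 3) ⊕ Fin 3 → ℤ) (Lc Ln : List (Fin 3 → ℤ)) (lamS : ℤ) : Bool :=
  (Lc.all fun b => labelOK c w b) && (Ln.all fun b => (naiveK c w b).isSome) &&
    hertzTest (fun i j => (Ec c Lc i j).add (En c w Ln i j)) (Wmat c w Lc) (lamS + remS c w Lc)

/-! ## §3. Auxiliary real facts -/

/-- The label sum of rank-one-plus-identity forms is the form of the summed array. [arithmetic] -/
theorem labelSum_eq_form {ι : Type*} (S : Finset ι) (α β : ι → ℝ) (cv : ι → E3) (Δ : E3) :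
    ∑ b ∈ S, (α b * ⟪cv b, Δ⟫ ^ 2 + β b * ‖Δ‖ ^ 2) = ∑ i, ∑ j, (∑ b ∈ S, (α b * (cv b i * cv b j) + (if i = j then β b else 0))) * (Δ i * Δ j) := by
  calc ∑ b ∈ S, (α b * ⟪cv b, Δ⟫ ^ 2 + β b * ‖Δ‖ ^ 2)
      = ∑ b ∈ S, ∑ i, ∑ j, (α b * (cv b i * cv b j) + (if i = j then β b else 0)) * (Δ i * Δ j) :=
        Finset.sum_congr rfl fun b _ => rankOne_term_eq_sum (α b) (β b) (cv b) Δ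
    _ = ∑ i, ∑ b ∈ S, ∑ j, (α b * (cv b i * cv b j) + (if i = j then β b else 0)) * (Δ i * Δ j) := Finset.sum_comm
    _ = ∑ i, ∑ j, ∑ b ∈ S, (α b * (cv b i * cv b j) + (if i = j then β b else 0)) * (Δ i * Δ j) :=
        Finset.sum_congr rfl fun i _ => Finset.sum_comm
    _ = ∑ i, ∑ j, (∑ b ∈ S, (α b * (cv b i * cv b j) + (if i = j then β b else 0))) * (Δ i * Δ j) :=
        Finset.sum_congr rfl fun i _ => Finset.sum_congr rfl fun j _ => by rw [Finset.sum_mul]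

/-- One remainder term: `(KS/SC)/2·(nd2/SC) ≤ cdiv(KS·nd2, 2SC)/SC`. [arithmetic] -/
theorem rem_term_le (K N : ℤ) : (K : ℝ) / SC / 2 * ((N : ℝ) / SC) ≤ ((cdiv (K * N) (2 * SC) : ℤ) : ℝ) / SC := by
  have hS : (0 : ℝ) < SC := by norm_num [SC]
  have h := div_le_cdiv (a := K * N) (b := 2 * (SC : ℤ)) (by norm_num [SC])
  push_cast at h
  have e : (K : ℝ) / SC / 2 * ((N : ℝ) / SC) = ((K : ℝ) * N / (2 * SC)) / SC := by field_simp
  rw [e]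
  exact div_le_div_of_nonneg_right h hS.le

/-- The remainder sum is below `remS/SC`. [arithmetic] -/
theorem rem_sum_le (c w : (Fin 3 × Fin 3) ⊕ Fin 3 → ℤ) {Lc : List (Fin 3 → ℤ)} (hLc : Lc.Nodup) :
    ∑ b ∈ Lc.toFinset, (KSof c w b : ℝ) / SC / 2 * ((nd2S c w b : ℝ) / SC) ≤ (remS c w Lc : ℝ) / SC := by
  classical
  have h1 : ∑ b ∈ Lc.toFinset, (KSof c w b : ℝ) / SC / 2 * ((nd2S c w b : ℝ) / SC) ≤
      ∑ b ∈ Lc.toFinset, ((cdiv (KSof c w b * nd2S c w b) (2 * SC) : ℤ) : ℝ) / SC := Finset.sum_le_sum fun b _ => rem_term_le _ _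
  refine h1.trans (le_of_eq ?_)
  rw [← Finset.sum_div]
  congr 1
  rw [List.sum_toFinset _ hLc, remS, Int.cast_list_sum, List.map_map]
  rfl


/-- Splitting a form over a sum of three arrays. [arithmetic] -/
theorem form_add3 (M N P : Fin 3 → Fin 3 → ℝ) (x : Fin 3 → ℝ) :
    ∑ i, ∑ j, (M i j + N i j + P i j) * (x i * x j) =
      (∑ i, ∑ j, M i j * (x i * x j)) + (∑ i, ∑ j, N i j * (x i * x j)) + ∑ i, ∑ j, P i j * (x i * x j) := by
  simp only [add_mul, Finset.sum_add_distrib]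

/-! ## §4. ★★★ Soundness -/

/-- ★★★ **SOUNDNESS OF THE CENTRED CURVATURE LEAF.**  If `curvCheckL c w Lc Ln lamS = true` (`Lc ++ Ln` duplicate-free) then for every `U` with entries
in the box and `‖U − 1‖ ≤ 1/4`, all shuffles `ξ₀, ξ` in the box with `‖ξ₀‖, ‖ξ‖ ≤ 1/4`, and every `s ∈ (0,1)` at which the radii
`‖latPt U hexFrame b + U(hcpShift + ξ₀) + s·U(ξ − ξ₀)‖`, `b ∈ Lc ++ Ln`, avoid the junction radii:
`(lamS/SC)·‖U(ξ − ξ₀)‖² ≤ Σ_{b ∈ (Lc ++ Ln).toFinset} segGd (deriv W₄₅) (latPt U hexFrame b + U(hcpShift + ξ₀)) (U(ξ − ξ₀)) s` — the `hcurv` input of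
`…HomConvexSegmentW45.hcpShifted_floor_W45`, exactly as `…HomCurvLeaf.curv_floor_of_curvCheck2`. [folklore chaining] -/
theorem curv_floor_of_curvCheckL {c w : (Fin 3 × Fin 3) ⊕ Fin 3 → ℤ} {Lc Ln : List (Fin 3 → ℤ)} (hL : (Lc ++ Ln).Nodup) {lamS : ℤ}
    (h : curvCheckL c w Lc Ln lamS = true) (U : E3 →L[ℝ] E3) (hU : ‖U - 1‖ ≤ 1 / 4)
    (hbox : ∀ ab : Fin 3 × Fin 3, |(U (EuclideanSpace.single ab.2 (1 : ℝ))) ab.1 - (c (Sum.inl ab) : ℝ) / SC| ≤ (w (Sum.inl ab) : ℝ) / SC)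
    (ξ₀ ξ : E3) (hξ₀ : ∀ i : Fin 3, |ξ₀ i - (c (Sum.inr i) : ℝ) / SC| ≤ (w (Sum.inr i) : ℝ) / SC)
    (hξ : ∀ i : Fin 3, |ξ i - (c (Sum.inr i) : ℝ) / SC| ≤ (w (Sum.inr i) : ℝ) / SC) (hn₀ : ‖ξ₀‖ ≤ 1 / 4) (hn : ‖ξ‖ ≤ 1 / 4)
    {s : ℝ} (hs : s ∈ Set.Ioo (0 : ℝ) 1)
    (hgood : ∀ b ∈ (Lc ++ Ln).toFinset, segR (latPt U hexFrame b + U (hcpShift + ξ₀)) (U (ξ - ξ₀)) s ∉ junctions) :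
    (lamS : ℝ) / SC * ‖U (ξ - ξ₀)‖ ^ 2 ≤
      ∑ b ∈ (Lc ++ Ln).toFinset, segGd (deriv (effPot w₄₅ ω₄ (3 / 400))) (latPt U hexFrame b + U (hcpShift + ξ₀)) (U (ξ - ξ₀)) s := by
  classical
  have hS : (0 : ℝ) < SC := by norm_num [SC]
  -- unpack the Boolean and the lists
  unfold curvCheckL at h
  simp only [Bool.and_eq_true, List.all_eq_true] at h
  obtain ⟨⟨hcen, hnai⟩, hhz⟩ := h
  obtain ⟨hLc, hLn, hdisj⟩ := List.nodup_append.1 hL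
  have hdisj' : List.Disjoint Lc Ln := fun a ha hb => hdisj a ha a hb rfl
  -- the intermediate shuffle
  set η : E3 := ξ₀ + s • (ξ - ξ₀) with hη
  have hηbox : ∀ i : Fin 3, |η i - (c (Sum.inr i) : ℝ) / SC| ≤ (w (Sum.inr i) : ℝ) / SC := by
    intro i
    have : η i = ξ₀ i + s * (ξ i - ξ₀ i) := by simp [hη]
    rw [this]
    exact abs_sub_le_of_segment (hξ₀ i) (hξ i) hs.1.le hs.2.le
  have hηn : ‖η‖ ≤ 1 / 4 := by
    have hdec : η = (1 - s) • ξ₀ + s • ξ := by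
      rw [hη, smul_sub, sub_smul, one_smul]; abel
    rw [hdec]
    calc ‖(1 - s) • ξ₀ + s • ξ‖ ≤ ‖(1 - s) • ξ₀‖ + ‖s • ξ‖ := norm_add_le _ _
      _ = (1 - s) * ‖ξ₀‖ + s * ‖ξ‖ := by
          rw [norm_smul, norm_smul, Real.norm_eq_abs, Real.norm_eq_abs, abs_of_nonneg (by linarith [hs.2]), abs_of_nonneg hs.1.le]
      _ ≤ (1 - s) * (1 / 4) + s * (1 / 4) := by gcongr <;> linarith [hs.1, hs.2]
      _ = 1 / 4 := by ring
  have hpt : ∀ b : Fin 3 → ℤ, latPt U hexFrame b + U (hcpShift + ξ₀) + s • U (ξ - ξ₀) = latPt U hexFrame b + U (hcpShift + η) := by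
    intro b
    have : U (hcpShift + η) = U (hcpShift + ξ₀) + s • U (ξ - ξ₀) := by
      rw [hη, ← map_smul, ← map_add]; congr 1; abel
    rw [this, add_assoc]
  set Δ : E3 := U (ξ - ξ₀) with hΔ
  set cb : (Fin 3 → ℤ) → E3 := fun b => latPt U hexFrame b + U (hcpShift + η) with hcb
  set αT : ℝ → ℝ := fun r => (deriv (deriv (effPot w₄₅ ω₄ (3 / 400))) r - deriv (effPot w₄₅ ω₄ (3 / 400)) r / r) / r ^ 2 with hαT
  set βT : ℝ → ℝ := fun r => deriv (effPot w₄₅ ω₄ (3 / 400)) r / r with hβT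
  have hρpos : ∀ b : Fin 3 → ℤ, 0 < ‖cb b‖ := fun b => lt_trans (by norm_num) (norm_shifted_gt hU hηn b)
  have hsegR : ∀ b : Fin 3 → ℤ, segR (latPt U hexFrame b + U (hcpShift + ξ₀)) Δ s = ‖cb b‖ := by
    intro b; rw [segR, hpt]
  -- the summands are `αT‖c_b‖⟪c_b,Δ⟫² + βT‖c_b‖‖Δ‖²`
  have hsummand : ∀ b ∈ (Lc ++ Ln).toFinset,
      segGd (deriv (effPot w₄₅ ω₄ (3 / 400))) (latPt U hexFrame b + U (hcpShift + ξ₀)) Δ s = αT ‖cb b‖ * ⟪cb b, Δ⟫ ^ 2 + βT ‖cb b‖ * ‖Δ‖ ^ 2 := by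
    intro b _
    have h0 : segR (latPt U hexFrame b + U (hcpShift + ξ₀)) Δ s ≠ 0 := by rw [hsegR]; exact (hρpos b).ne'
    rw [segGd_eq_rankOne _ _ _ h0, hsegR, hpt]
  rw [Finset.sum_congr rfl hsummand, List.toFinset_append, Finset.sum_union (List.disjoint_toFinset_iff_disjoint.2 hdisj')]
  -- NAIVE part: box memberships (as `curv_floor_of_curvCheck2`)
  have hCn : ∀ (b : Fin 3 → ℤ) (a : Fin 3), FI.mem (cb b a) (vecB (boxE c w) (shufFI c w) b a) :=
    fun b a => mem_vecB U η (fun ab => mem_entryFI (hbox ab)) (fun i => mem_shufFI (hηbox i)) b a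
  have hQn : ∀ b : Fin 3 → ℤ, FI.mem (‖cb b‖ ^ 2) (dot3 (vecB (boxE c w) (shufFI c w) b) (vecB (boxE c w) (shufFI c w) b)) := by
    intro b; rw [← real_inner_self_eq_norm_sq]; exact mem_dot3 (hCn b) (hCn b)
  have hαn : ∀ b ∈ Ln, FI.mem (αT ‖cb b‖) ((naiveK c w b).getD (FI.ofInt 0, FI.ofInt 0)).1 ∧
      FI.mem (βT ‖cb b‖) ((naiveK c w b).getD (FI.ofInt 0, FI.ofInt 0)).2 := by
    intro b hb
    obtain ⟨AB, hAB⟩ := Option.isSome_iff_exists.1 (hnai b hb)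
    have hJ : ‖cb b‖ ∉ junctions := by
      rw [← hsegR]; exact hgood b (List.mem_toFinset.2 (List.mem_append_right _ hb))
    have := mem_coeffFI2 (hρpos b) hJ (hQn b) hAB
    rw [hAB]; simpa using this
  have hMn := fun i j => mem_hessEntryFI Ln hLn (fun b hb => (hαn b hb).1) (fun b hb => (hαn b hb).2) (fun b _ a => hCn b a) i j
  have hNsum := labelSum_eq_form Ln.toFinset (fun b => αT ‖cb b‖) (fun b => βT ‖cb b‖) cb Δ
  -- CENTRED part: the per-label floors
  have hlf := fun b (hb : b ∈ Lc) => label_floor (hcen b hb) U hbox η hηbox Δ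
  set pc : (Fin 3 → ℤ) → E3 := fun b => cenPt c b with hpc
  set a1 : (Fin 3 → ℤ) → ℝ := fun b => deriv αT ‖pc b‖ / ‖pc b‖ with ha1
  set D : (Fin 3 → ℤ) → Fin 3 → Fin 3 → Fin 3 → ℝ := fun b k i j => Dreal (a1 b) (αT ‖pc b‖) (pc b) k i j with hD
  have hfloor : ∀ b ∈ Lc.toFinset, αT ‖pc b‖ * ⟪pc b, Δ⟫ ^ 2 + βT ‖pc b‖ * ‖Δ‖ ^ 2 +
      ∑ i, ∑ j, (∑ k, (cb b - pc b) k * D b k i j) * (Δ i * Δ j) - (KSof c w b : ℝ) / SC / 2 * ((nd2S c w b : ℝ) / SC) * ‖Δ‖ ^ 2 ≤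
      αT ‖cb b‖ * ⟪cb b, Δ⟫ ^ 2 + βT ‖cb b‖ * ‖Δ‖ ^ 2 := fun b hb => (hlf b (List.mem_toFinset.1 hb)).2.2.2
  have hC := sum_floor_collect Lc.toFinset (fun b => αT ‖cb b‖ * ⟪cb b, Δ⟫ ^ 2 + βT ‖cb b‖ * ‖Δ‖ ^ 2)
    (fun b => αT ‖pc b‖ * ⟪pc b, Δ⟫ ^ 2 + βT ‖pc b‖ * ‖Δ‖ ^ 2) (fun b => (KSof c w b : ℝ) / SC / 2 * ((nd2S c w b : ℝ) / SC))
    (fun b k => (cb b - pc b) k) D Δ hfloor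
  have hqsum := labelSum_eq_form Lc.toFinset (fun b => αT ‖pc b‖) (fun b => βT ‖pc b‖) pc Δ
  have hMc := fun i j => mem_hessEntryFI Lc hLc (fun b hb => (hlf b hb).1) (fun b hb => (hlf b hb).2.1) (fun b _ a => mem_cenVec c b a) i j
  -- the perturbation array and its entrywise bound
  set P : Fin 3 → Fin 3 → ℝ := fun i j => ∑ b ∈ Lc.toFinset, ∑ k, (cb b - pc b) k * D b k i j with hP
  have hPbound : ∀ i j, |P i j| * SC ≤ (Wmat c w Lc i j : ℝ) := by
    intro i j
    have hd : ∀ (b : Fin 3 → ℤ) (k : Fin 3), (cb b - pc b) k =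
        ∑ l : Fin 3, ((U (EuclideanSpace.single l (1 : ℝ))) k - (c (Sum.inl (k, l)) : ℝ) / SC) * wPt c b l + (U (η - cenShuf c)) k :=
      fun b k => dVec_formula c U η b k
    have hre : P i j = ∑ k, ∑ l, ((U (EuclideanSpace.single l (1 : ℝ))) k - (c (Sum.inl (k, l)) : ℝ) / SC) *
        (∑ b ∈ Lc.toFinset, wPt c b l * D b k i j) + ∑ k, (U (η - cenShuf c)) k * ∑ b ∈ Lc.toFinset, D b k i j := by
      rw [hP]
      simp only []
      rw [Finset.sum_congr rfl fun b _ => Finset.sum_congr rfl fun k _ => by rw [hd b k]]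
      exact pert_rearrange Lc.toFinset (fun k l => (U (EuclideanSpace.single l (1 : ℝ))) k - (c (Sum.inl (k, l)) : ℝ) / SC)
        (fun k => (U (η - cenShuf c)) k) (fun b l => wPt c b l) (fun b k => D b k i j)
    have hG : ∀ k l, FI.mem (∑ b ∈ Lc.toFinset, wPt c b l * D b k i j) (Garr c w Lc k l i j) := by
      intro k l
      refine mem_accFI Lc hLc fun b hb => ?_
      rw [mul_comm]
      exact FI.mem_mul (mem_Darr (L := recOf c w b) (hlf b hb).2.2.1 (hlf b hb).1 (fun a => mem_cenVec c b a) k i j) (mem_wVec c b l)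
    have hT : ∀ k, FI.mem (∑ b ∈ Lc.toFinset, D b k i j) (Tarr c w Lc k i j) := by
      intro k
      exact mem_accFI Lc hLc fun b hb => mem_Darr (L := recOf c w b) (hlf b hb).2.2.1 (hlf b hb).1 (fun a => mem_cenVec c b a) k i j
    have habs := pert_abs_le (fun k l => (U (EuclideanSpace.single l (1 : ℝ))) k - (c (Sum.inl (k, l)) : ℝ) / SC)
      (fun k l => ∑ b ∈ Lc.toFinset, wPt c b l * D b k i j) (fun k l => (w (Sum.inl (k, l)) : ℝ) / SC)
      (fun k l => ((Garr c w Lc k l i j).absHi : ℝ) / SC) (fun k => (U (η - cenShuf c)) k) (fun k => ∑ b ∈ Lc.toFinset, D b k i j)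
      (fun k => (uBound c w k : ℝ) / SC) (fun k => ((Tarr c w Lc k i j).absHi : ℝ) / SC)
      (fun k l => hbox (k, l)) (fun k l => by rw [le_div_iff₀ hS]; exact FI.abs_le_absHi (hG k l))
      (fun k => by rw [le_div_iff₀ hS]; exact abs_shift_le U hbox η hηbox k) (fun k => by rw [le_div_iff₀ hS]; exact FI.abs_le_absHi (hT k))
    rw [← hre] at habs
    have hsum : (∑ k : Fin 3, ∑ l : Fin 3, (w (Sum.inl (k, l)) : ℝ) / SC * (((Garr c w Lc k l i j).absHi : ℝ) / SC) +
        ∑ k : Fin 3, (uBound c w k : ℝ) / SC * (((Tarr c w Lc k i j).absHi : ℝ) / SC)) * SC =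
        ((∑ k : Fin 3, ∑ l : Fin 3, w (Sum.inl (k, l)) * (Garr c w Lc k l i j).absHi + ∑ k : Fin 3, uBound c w k * (Tarr c w Lc k i j).absHi : ℤ) : ℝ) / SC := by
      push_cast
      rw [eq_div_iff hS.ne']
      simp only [add_mul, Finset.sum_mul]
      congr 1
      · refine Finset.sum_congr rfl fun k _ => Finset.sum_congr rfl fun l _ => ?_
        field_simp
      · refine Finset.sum_congr rfl fun k _ => ?_
        field_simp
    have hcd := div_le_cdiv (a := ∑ k : Fin 3, ∑ l : Fin 3, w (Sum.inl (k, l)) * (Garr c w Lc k l i j).absHi +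
      ∑ k : Fin 3, uBound c w k * (Tarr c w Lc k i j).absHi) (b := (SC : ℤ)) (by exact_mod_cast hS)
    calc |P i j| * SC ≤ _ := mul_le_mul_of_nonneg_right habs hS.le
      _ = _ := hsum
      _ ≤ (Wmat c w Lc i j : ℝ) := by rw [Wmat]; exact_mod_cast hcd
  -- remainder
  have hR := rem_sum_le c w (Lc := Lc) hLc
  -- the sign-vertex test
  have key := quadForm_ge_of_hertzTest hhz (M := fun i j => (∑ b ∈ Lc.toFinset, (αT ‖pc b‖ * (pc b i * pc b j) + if i = j then βT ‖pc b‖ else 0)) +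
      ∑ b ∈ Ln.toFinset, (αT ‖cb b‖ * (cb b i * cb b j) + if i = j then βT ‖cb b‖ else 0)) (P := P)
    (fun i j => FI.mem_add (hMc i j) (hMn i j)) hPbound (fun i => Δ i)
  rw [form_add3, ← hqsum, ← hNsum, ← norm_sq_eq_sum] at key
  have hΔ2 : 0 ≤ ‖Δ‖ ^ 2 := sq_nonneg _
  have hcast : (((lamS + remS c w Lc : ℤ) : ℝ)) / SC = (lamS : ℝ) / SC + (remS c w Lc : ℝ) / SC := by push_cast; ring
  rw [hcast] at key
  have hRle : (∑ b ∈ Lc.toFinset, (KSof c w b : ℝ) / SC / 2 * ((nd2S c w b : ℝ) / SC)) * ‖Δ‖ ^ 2 ≤ (remS c w Lc : ℝ) / SC * ‖Δ‖ ^ 2 :=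
    mul_le_mul_of_nonneg_right hR hΔ2
  nlinarith [key, hC, hRle, hΔ2]

end Summit.AtomisticToContinuum.Crystallization.Theorems.FrustratedLawDichotomyStrainedPatchHomCurvLeafL

end
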